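import Summits.CriticalPhenomena.PercolationContinuityZ3.Theorems.PercNearOneGluingNoHeavyRsw3CouplingSimultaneousUniqueness
import Literature.Barriers.CriticalPhenomena.SubexponentialGrowthZdFMSF
import HarnessLib

/-!
# RSW3 lane (P2, gen 30): THE WIRED MINIMAL SPANNING FOREST, VII — **`WMSF = FMSF` ALMOST SURELY ON `ℤ^d`** (Lyons–Peres 2016 Prop. 11.7 / Exercise 11.8(c);
# Lyons–Peres–Schramm 2006 Prop. 3.6), from SIMULTANEOUS UNIQUENESS of the strict level configurations `{U < c}`

builds on p205010 (kernel theorem, internal audit signed; external expert review pending) — used only to dispose of the levels `c ≤ p_c` (file II of the coupling series).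

Cell `prim-rsw3`, prover seat `prim-rsw3-p2` (gen 30), memo `run/shared/lean/prim/rsw3/P2-RSWLITE.md` §37.  Support file
(`--supports stmt-CriticalPhenomena-4575`); no definitions, no named facts, no sorries.  `𝔉_w(U) = wmsf G U` (gen 29, LPS finite-cut form), `𝔉_f(U) = fmsf E(G) U` (the Barriers
library's free minimal spanning forest: `[u, v] ∈ 𝔉_f` iff `u, v` are not joined by bonds `≠ [u,v]` of label `≤ U[u,v]`), `κ_c(U) = {g ∈ E(G) : U g < c}` the STRICT level-`c`
configuration of the standard coupling.

* §1 (deterministic, every locally finite graph): `wmsf_subset_fmsf` (every label field); **`infinite_ltCluster_of_mem_fmsf_of_not_mem_wmsf`** — for injective labels, a bond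
  `e = [u, v] ∈ 𝔉_f ∖ 𝔉_w` has BOTH endpoints in infinite `κ_{U e}`-clusters, and these are distinct (Lyons–Peres' event `A(e)`, proof of Prop. 11.7).
* §2 (`ℤ^d`, `d ≥ 2`): `invasion_subset_ltCluster` (strict absorption: the invasion from `x` stays inside an infinite `κ_c`-cluster of `x`);
  **`ae_ltConfig_infinite_clusters_reachable`** — a.s., SIMULTANEOUSLY FOR ALL LEVELS `c`, the strict configuration `{U < c}` has at most one infinite cluster (invasion of
  infinite clusters, coupling file I, + simultaneous uniqueness, coupling file II); **`ae_wmsf_eq_fmsf`** — a.s. `𝔉_w(U) = 𝔉_f(U)` on `ℤ^d`; `ae_wmsf_eq_fmsf_Z3`.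

References: R. Lyons, Y. Peres, *Probability on Trees and Networks* (2016), Prop. 11.7 and its proof (the event `A(e)`), Exercise 11.8 (c) [LyonsPeres2016]; R. Lyons, Y. Peres,
O. Schramm, Ann. Probab. 34 (2006) Prop. 3.6 [LyonsPeresSchramm2006]; K. S. Alexander, Ann. Probab. 23 (1995) 87–104 (ℤ^d) [LyonsPeres2016].
-/

noncomputable section

namespace Summit.CriticalPhenomena.PercolationContinuityZ3.Theorems.Rsw3

open Finset Filter MeasureTheory Literature.Probability.LatticeModels Literature.Probability.Percolation
open Literature.Probability.Percolation.Invasion Literature.Barriers.CriticalPhenomena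

section General

variable {V : Type*} [DecidableEq V] {G : SimpleGraph V} [G.LocallyFinite]

/-! ## §1 `𝔉_w ⊆ 𝔉_f`, and the bonds of `𝔉_f ∖ 𝔉_w` -/

/-- **`𝔉_w(U) ⊆ 𝔉_f(U)`** for every label field: a bond that is the strict minimum of a finite cut cannot be the endpoint-connection of bonds of smaller-or-equal label
(such a connection would cross the cut elsewhere). [cite: LyonsPeres2016, §11.1 (𝔉_w ⊂ 𝔉_f)] [cite: LyonsPeresSchramm2006, §3 (F_w ⊆ F_f)] -/
theorem wmsf_subset_fmsf (U : Sym2 V → ℝ) : wmsf G U ⊆ fmsf G.edgeSet U := by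
  rintro e ⟨W, a, haW, rfl, hmin⟩
  obtain ⟨ha1, ha2, hadj⟩ := (mem_boundaryDarts G).1 haW
  refine mk_mem_fmsf_iff.2 ⟨(SimpleGraph.mem_edgeSet G).2 hadj, hadj.ne, fun hreach => ?_⟩
  have hle : openGraph (belowConfig G.edgeSet U s(a.1, a.2)) ≤ G := by
    intro x y hxy
    rw [openGraph_adj] at hxy
    exact (SimpleGraph.mem_edgeSet G).1 hxy.1.1
  obtain ⟨b, hbW, hbadj⟩ := exists_boundaryDart_of_reachable hle hreach ha1 ha2
  rw [openGraph_adj] at hbadj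
  obtain ⟨⟨-, hne, hle'⟩, -⟩ := hbadj
  exact absurd (hmin b hbW hne) (not_lt.2 hle')

/-- One side of Lyons–Peres' event `A(e)`: if `e = [u, v] ∈ 𝔉_f(U)` (injective `U`) and the STRICT level-`U e` cluster of `u` is finite, then `e ∈ 𝔉_w(U)` (that finite cluster is a
finite cut of which `e` is the strictly smallest bond). [cite: LyonsPeres2016, Prop. 11.7 (proof: A(e))] -/
theorem mem_wmsf_of_finite_ltCluster {U : Sym2 V → ℝ} (hU : Function.Injective U) {u v : V} (he : s(u, v) ∈ fmsf G.edgeSet U)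
    (hfin : (openCluster {g : Sym2 V | g ∈ G.edgeSet ∧ U g < U s(u, v)} u).Finite) : s(u, v) ∈ wmsf G U := by
  classical
  obtain ⟨huv, hne, hnot⟩ := mk_mem_fmsf_iff.1 he
  set κ : BondConfig V := {g : Sym2 V | g ∈ G.edgeSet ∧ U g < U s(u, v)} with hκ
  have hvC : v ∉ openCluster κ u := by
    intro hv
    refine hnot (SimpleGraph.Reachable.mono (openGraph_mono fun g hg => ?_) hv)
    exact ⟨hg.1, fun h => by rw [h] at hg; exact lt_irrefl _ hg.2, hg.2.le⟩
  refine (mem_wmsf G).2 ⟨hfin.toFinset, (u, v), ?_, rfl, fun b hb hbne => ?_⟩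
  · rw [mem_boundaryDarts]
    exact ⟨hfin.mem_toFinset.2 (SimpleGraph.Reachable.refl _), fun h => hvC (hfin.mem_toFinset.1 h), (SimpleGraph.mem_edgeSet G).1 huv⟩
  · obtain ⟨hb1, hb2, hbadj⟩ := (mem_boundaryDarts G).1 hb
    rw [Set.Finite.mem_toFinset] at hb1 hb2
    have hnotin : s(b.1, b.2) ∉ κ := fun hin =>
      hb2 (SimpleGraph.Reachable.trans hb1 (SimpleGraph.Adj.reachable ((openGraph_adj _ _ _).2 ⟨hin, hbadj.ne⟩)))
    have hge : ¬ U s(b.1, b.2) < U s(u, v) := fun h => hnotin ⟨(SimpleGraph.mem_edgeSet G).2 hbadj, h⟩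
    exact lt_of_le_of_ne (not_lt.1 hge) fun h => hbne (hU h).symm

/-- **The bonds of `𝔉_f ∖ 𝔉_w`** (injective labels): both endpoints of `e = [u, v] ∈ 𝔉_f(U) ∖ 𝔉_w(U)` lie in INFINITE clusters of the strict configuration `{U < U e}`, and these
clusters are distinct. [cite: LyonsPeres2016, Prop. 11.7 (proof: "A(e) is the same as the event that e ∈ 𝔉_f ∖ 𝔉_w")] -/
theorem infinite_ltCluster_of_mem_fmsf_of_not_mem_wmsf {U : Sym2 V → ℝ} (hU : Function.Injective U) {u v : V} (he : s(u, v) ∈ fmsf G.edgeSet U)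
    (hnot : s(u, v) ∉ wmsf G U) :
    (openCluster {g : Sym2 V | g ∈ G.edgeSet ∧ U g < U s(u, v)} u).Infinite ∧
      (openCluster {g : Sym2 V | g ∈ G.edgeSet ∧ U g < U s(u, v)} v).Infinite ∧
      ¬ (openGraph {g : Sym2 V | g ∈ G.edgeSet ∧ U g < U s(u, v)}).Reachable u v := by
  refine ⟨fun hfin => hnot (mem_wmsf_of_finite_ltCluster hU he hfin), fun hfin => hnot ?_, fun hreach => ?_⟩
  · have he' : s(v, u) ∈ fmsf G.edgeSet U := by rw [Sym2.eq_swap]; exact he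
    have h := mem_wmsf_of_finite_ltCluster hU he' (by rw [Sym2.eq_swap]; exact hfin)
    rwa [Sym2.eq_swap] at h
  · refine (mk_mem_fmsf_iff.1 he).2.2 (SimpleGraph.Reachable.mono (openGraph_mono fun g hg => ?_) hreach)
    exact ⟨hg.1, fun h => by rw [h] at hg; exact lt_irrefl _ hg.2, hg.2.le⟩

/-- **Strict absorption**: if the strict level-`c` cluster of `x` is infinite, the invasion from `x` never leaves it. [cite: LyonsPeres2016, §7.5 p. 360 (I(x) ⊆ η)] -/
theorem invasion_subset_ltCluster {U : Sym2 V → ℝ} {x : V} {c : ℝ}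
    (hinf : (openCluster {g : Sym2 V | g ∈ G.edgeSet ∧ U g < c} x).Infinite) (n : ℕ) :
    ↑(invasion G U x n) ⊆ openCluster {g : Sym2 V | g ∈ G.edgeSet ∧ U g < c} x := by
  classical
  set κ : BondConfig V := {g : Sym2 V | g ∈ G.edgeSet ∧ U g < c} with hκ
  have hle : openGraph κ ≤ G := fun a b hab => by rw [openGraph_adj] at hab; exact (SimpleGraph.mem_edgeSet G).1 hab.1.1
  induction n with
  | zero => intro y hy; rw [invasion_zero, coe_singleton, Set.mem_singleton_iff] at hy; subst hy; exact SimpleGraph.Reachable.refl _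
  | succ n ih =>
    intro y hy
    rw [invasion_succ] at hy
    cases hd : newDart G U (invasion G U x n) with
    | none => rw [step_of_eq_none G hd] at hy; exact ih hy
    | some a =>
      rw [step_of_eq_some G hd, coe_insert, Set.mem_insert_iff] at hy
      rcases hy with rfl | hy
      · -- the accepted label is `< c`: the infinite cluster leaves `I_n` through a `κ`-bond
        obtain ⟨z, hzC, hzI⟩ := hinf.exists_notMem_finset (invasion G U x n)
        obtain ⟨b, hb, hbadj⟩ := exists_boundaryDart_of_reachable hle hzC (root_mem_invasion U x n) hzI
        rw [openGraph_adj] at hbadj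
        have hlt : U s(a.1, a.2) < c := (label_newDart_le hd hb).trans_lt hbadj.1.2
        have ha1 : a.1 ∈ openCluster κ x := ih (Finset.mem_coe.2 (fst_mem_of_newDart hd))
        exact SimpleGraph.Reachable.trans ha1 (SimpleGraph.Adj.reachable ((openGraph_adj _ _ _).2
          ⟨⟨adj_of_newDart hd, hlt⟩, (adj_of_newDart hd).ne⟩))
      · exact ih hy

end General

/-! ## §2 `ℤ^d`: one infinite cluster at every strict level, and `WMSF = FMSF` -/

variable {d : ℕ}

/-- **SIMULTANEOUS UNIQUENESS FOR THE STRICT CONFIGURATIONS**: almost surely, for EVERY real level `c` at once, any two vertices with infinite `{U < c}`-clusters are joined by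
a `{U < c}`-open path (`d ≥ 2`): for `c ≤ p_c` there is no infinite cluster (p205010, coupling file II); for `c > p_c` both invasions stay in their infinite clusters and meet the
unique infinite `η_q`-cluster, `p_c < q < c` (coupling files I–II). [cite: LyonsPeres2016, Thm. 7.21 and Thm. 7.22] [cite: AlexanderSimultaneousUniqueness1995, Theorem] -/
theorem ae_ltConfig_infinite_clusters_reachable (hd : 2 ≤ d) :
    ∀ᵐ U ∂(labelMeasure (Site d)), ∀ c : ℝ, ∀ x y : Site d,
      (openCluster {g : Sym2 (Site d) | g ∈ (zdGraph d).edgeSet ∧ U g < c} x).Infinite →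
      (openCluster {g : Sym2 (Site d) | g ∈ (zdGraph d).edgeSet ∧ U g < c} y).Infinite →
        (openGraph {g : Sym2 (Site d) | g ∈ (zdGraph d).edgeSet ∧ U g < c}).Reachable x y := by
  filter_upwards [ae_forall_invadedRegion_meets_infinite_cluster hd, ae_forall_reachable_of_percolatesAt hd,
    ae_forall_numInfiniteClusters_eq_zero_of_le hd] with U hinv huniq hzero
  intro c x y hx hy
  set κ : BondConfig (Site d) := {g : Sym2 (Site d) | g ∈ (zdGraph d).edgeSet ∧ U g < c} with hκ
  -- `c > p_c`
  have hc : criticalProb (zdGraph d) (0 : Site d) < c := by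
    by_contra hle
    rw [not_lt] at hle
    have hsub : κ ⊆ configOfLabels c U (zdGraph d) := fun g hg => ⟨hg.1, hg.2.le⟩
    have hperc : configOfLabels c U (zdGraph d) ∈ percolatesAt x := hx.mono (openCluster_mono hsub x)
    have h0 := hzero c hle
    exact (numInfiniteClusters_ne_zero_iff _).2 ⟨x, hperc⟩ h0
  -- a level strictly between
  set q : ℝ := (criticalProb (zdGraph d) (0 : Site d) + c) / 2 with hq
  have hq1 : criticalProb (zdGraph d) (0 : Site d) < q := by rw [hq]; linarith
  have hq2 : q < c := by rw [hq]; linarith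
  have hsubq : configOfLabels q U (zdGraph d) ⊆ κ := fun g hg => ⟨hg.1, hg.2.trans_lt hq2⟩
  -- each invasion meets the infinite `η_q`-cluster, inside its own `κ`-cluster
  have hmeet : ∀ z : Site d, (openCluster κ z).Infinite → ∃ u, (openGraph κ).Reachable z u ∧ configOfLabels q U (zdGraph d) ∈ percolatesAt u := by
    intro z hz
    obtain ⟨u, huI, hu⟩ := hinv q hq1 z
    obtain ⟨n, hn⟩ := (mem_invadedRegion (zdGraph d)).1 huI
    exact ⟨u, invasion_subset_ltCluster hz n (Finset.mem_coe.2 hn), hu⟩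
  obtain ⟨u, hxu, hu⟩ := hmeet x hx
  obtain ⟨u', hyu', hu'⟩ := hmeet y hy
  have huu' : (openGraph κ).Reachable u u' := (huniq q hq1 u u' hu hu').mono (openGraph_mono hsubq)
  exact hxu.trans (huu'.trans hyu'.symm)

/-- **`WMSF = FMSF` ALMOST SURELY ON `ℤ^d`, `d ≥ 2`** (Lyons–Peres 2016 Prop. 11.7 with a.e. uniqueness — here from simultaneous uniqueness of the strict configurations: a bond of
`𝔉_f ∖ 𝔉_w` would have its endpoints in two distinct infinite `{U < U e}`-clusters). [cite: LyonsPeres2016, Prop. 11.7 and Exercise 11.8 (c)] [cite: LyonsPeresSchramm2006, Prop. 3.6] -/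
theorem ae_wmsf_eq_fmsf (hd : 2 ≤ d) :
    ∀ᵐ U ∂(labelMeasure (Site d)), wmsf (zdGraph d) U = fmsf (zdGraph d).edgeSet U := by
  filter_upwards [ae_ltConfig_infinite_clusters_reachable hd, Literature.Barriers.CriticalPhenomena.ae_injective_labelMeasure (V := Site d)] with U hU hinj
  refine Set.Subset.antisymm (wmsf_subset_fmsf U) fun e he => ?_
  induction e using Sym2.ind with
  | h u v =>
    by_contra hnot
    obtain ⟨hu, hv, hne⟩ := infinite_ltCluster_of_mem_fmsf_of_not_mem_wmsf hinj he hnot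
    exact hne (hU _ u v hu hv)

/-- `ℤ³`: almost surely the wired and free minimal spanning forests of `ℤ³` coincide. [cite: LyonsPeres2016, Prop. 11.7 and Exercise 11.8 (c)] -/
theorem ae_wmsf_eq_fmsf_Z3 : ∀ᵐ U ∂(labelMeasure (Site 3)), wmsf (zdGraph 3) U = fmsf (zdGraph 3).edgeSet U :=
  ae_wmsf_eq_fmsf (d := 3) (by norm_num)

end Summit.CriticalPhenomena.PercolationContinuityZ3.Theorems.Rsw3
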